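/-
Copyright (c) 2026 the pub-hodgecm-mathlib formalisation cell (harness21).  Prover seat hodgecm-mathlib-K2E3-p33 (g0), HCML Track B «K2-LIT»
(build stream 29), h413 = `stmt-HodgeConjecture-24833`, line `K2_E3_EllipticInputs`, unit U12 «Characters», CLOSE-OUT strike line L4 `stub_StCharTS`, letter (SC-an)₂
(PART «SC» :98) — TWO OF THE FIVE LETTERS OF THE (M5h)₂ PAYER, IN THE PAYER'S CURRENCY: (TORΩ₂) «a conjugate of a diagonal `t` in `Ω_m` has `|ϖ^m d_i^{±1}| ≤ 1`» and
(DEPTH₂) «`‖ϖ‖^τ ≤ T(t) ⇒ λ(t) ≤ 4τ + 10m`» (binder desk K2E3-p23 (g7), `K2/STATUS.md` 2026-09-04T15:13:12Z; LINE-LEAD K2E3-plan (g4)).  2026-09-04.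
-/
import Summits.HodgeConjecture.HodgeConjecture.Theorems.K2E3SplitTorusDepthFromDiscriminantTwo   -- ★ p861199 (this seat) (M5e-2)₂: `v_pow_le_v_sub_of_pow_normAbs_le_token` (the SHARP depth `4τ + 4m` at `2 × 2`)
import Summits.HodgeConjecture.HodgeConjecture.Theorems.K2E3ConjugatorHeightControlRankOneTwo     -- ★ p861205 (K2E3-p34 g0) (D2)₂: `mem_heightBall_torus_of_conj_mem` (`y t y⁻¹ ∈ Ω_m ⇒ t ∈ Ω_m`); brings ★ `K2E3CuspFormCancellationU3Torus.coe_inv_glDiagonal` (any rank), ★ `coe_glDiagonal`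
import HarnessLib

/-!
# K2_E3 road (h413), letter (SC-an)₂: THE LETTERS (TORΩ₂) AND (DEPTH₂) OF THE (M5h)₂ PAYER, BYTE-EXACT
# (Harish-Chandra 1970, Part VII §2 p. 69, §3 pp. 71–72; Rogawski 1990, §3.1 p. 19)

Cell `pub/hodgecm-mathlib`, Track B «K2-LIT», crux H413 = `stmt-HodgeConjecture-24833` (`--supports … --as helper`, count-neutral).  THEOREMS ONLY (no `def`, no
`instance`, no `notation`, no named-fact hypothesis, no `sorry`).

WHAT.  The TOP (M5h)₂ payer `K2E3SupercuspidalTruncatedCharAnalyticTwoOfEllWeight.sigSCanTwo_of_ellWeightPlace_two (hLIM hSHELL hTOK hTORΩ hDEPTH)` (K2E3-p23 (g7), GREEN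
2026-09-04T15:13Z) turns the (M5h)₂ socket of PART «SC» into a theorem REL over EXACTLY five ∀-closed `N = 2` letters.  This file PAYS two of them, with statements that are the
payer's binder TYPES token for token (so the payer docks BY NAME: `hTORΩ := torusOmega_letter`, `hDEPTH := depth_letter`):
* **(TORΩ₂) `torusOmega_letter`** — on `U(σ, Φ₂)(K)` with the height balls `Ω` read through `hmem`: if `t = diag d` and `y t y⁻¹ ∈ Ω_m` then `|ϖ^m dᵢ| ≤ 1` and `|ϖ^m dᵢ⁻¹| ≤ 1`
  (`i = 0, 1`).  Proof = the `N = 3` template ★ `K2E3SupercuspBallBoundSplitAssembly.v_pow_mul_torus_le_one_of_conj_mem` :291 verbatim over ★ (D2)₂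
  `K2E3ConjugatorHeightControlRankOneTwo.mem_heightBall_torus_of_conj_mem` (K2E3-p34 (g0), which needs neither `σ ∘ σ = id` nor `|ϖ| = q⁻¹`; those two binders of the letter
  are therefore idle here and `_`-named).
* **(DEPTH₂) `depth_letter`** — for `t = diag d` with `|ϖ^m dᵢ^{±1}| ≤ 1`, `|ϖ| = exp(−1)` and `‖ϖ‖^τ ≤ T(t) = √√(‖disc χ_t‖·‖det t‖⁻²)`: `∀ i ≠ k, v(ϖ^{4τ+10m}) ≤ v(dᵢ − dₖ)` — the
  payer froze the `N = 3` constant `10m`; ★ (M5e-2)₂ `K2E3SplitTorusDepthFromDiscriminantTwo.v_pow_le_v_sub_of_pow_normAbs_le_token` gives the SHARPER `4τ + 4m` (and does not use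
  `|ϖ^m dᵢ| ≤ 1`, idle here), and `v(ϖ^{4τ+10m}) ≤ v(ϖ^{4τ+4m})` because `|ϖ| ≤ 1`.

HONEST LABEL: HC_CM is proved only modulo the 7 printed citations (2 remaining named inputs: hLiu418 = `stmt-HodgeConjecture-24832`, h413 =
`stmt-HodgeConjecture-24833`) until rung 0 closes; this file is a count-neutral helper (valuation bookkeeping; nothing printed is asserted as a fact); after it the (M5h)₂
socket is REL over {LIM₂, SHELL₂, TOK₂} only once the payer is ★ — REL ≠ ★.

## References
* [HarishChandra1970] Harish-Chandra (notes by G. van Dijk), *Harmonic Analysis on Reductive p-adic Groups*, LNM 162 (1970), Part VII §2 p. 69 (`‖x‖`, `Ω`, `q^{λ(x)} = |D(x)|`),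
  §3 pp. 71–72.
* [Rogawski1990] J. D. Rogawski, *Automorphic Representations of Unitary Groups in Three Variables*, Ann. of Math. Stud. 123 (1990), §3.1 p. 19 (regular elements, `D_G`).
-/

set_option autoImplicit false
-- the mandated namespace repeats the single-problem summit's segment (`HodgeConjecture.HodgeConjecture`)
set_option linter.dupNamespace false

noncomputable section

open scoped NNReal MatrixGroups WithZero
open Literature.NumberTheory.Automorphic Literature.NumberTheory.Automorphic.UnitaryGroup Literature.NumberTheory.Automorphic.HermitianLattice
open Literature.NumberTheory.GaloisRepresentations Literature.NumberTheory.GaloisRepresentations.IsNonarchimedeanLocalField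

namespace Summit.HodgeConjecture.HodgeConjecture.Cruxes.H413.K2E3SupercuspidalTruncatedCharTorusDepthLettersTwo

/-! ## §1 (TORΩ₂): on `Ω_m` the torus entries are controlled -/

set_option maxHeartbeats 800000 in -- long ∀-closed statement (the payer's letter type verbatim)
/-- **(TORΩ₂) — THE PAYER'S LETTER `hTORΩ`, BYTE-EXACT**: on `U(σ, Φ₂)(K)`, if `t = diag d` is conjugate into `Ω_m` (`y t y⁻¹ ∈ Ω_m`) then `|ϖ^m dᵢ| ≤ 1` and `|ϖ^m dᵢ⁻¹| ≤ 1`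
for every `i` (★ (D2)₂ `mem_heightBall_torus_of_conj_mem`, then the diagonal entries of `t^{±1}` through `hmem`; the letter's `σ ∘ σ = id` and `|ϖ| = exp(−1)` binders are idle).
[cite: HarishChandra1970, Part VII §2 p. 69] [cite: Rogawski1990, §3.1 p. 19] -/
theorem torusOmega_letter :
    ∀ (K : Type) [Field K] [Valued K ℤᵐ⁰] [ValuativeRel K] [(Valued.v : Valuation K ℤᵐ⁰).Compatible] [IsNonarchimedeanLocalField K] [CharZero K]
      (σ : K →+* K), (∀ x, σ (σ x) = x) → (∀ x, Valued.v (σ x) = Valued.v x) → ∀ {ϖ : K}, Valued.v ϖ = WithZero.exp (-1 : ℤ) → ∀ {J : Matrix (Fin 2) (Fin 2) K}, J = (StdForm.antidiagonal 2).over K →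
      ∀ (Ω : CompactExhaustion ↥(unitaryGroupOfForm σ J)), (∀ (m : ℕ) (g : ↥(unitaryGroupOfForm σ J)), g ∈ Ω m ↔ (∀ i j, Valued.v (ϖ ^ m * ((g : GL (Fin 2) K) : Matrix (Fin 2) (Fin 2) K) i j) ≤ 1) ∧
          ∀ i j, Valued.v (ϖ ^ m * (((g : GL (Fin 2) K)⁻¹ : GL (Fin 2) K) : Matrix (Fin 2) (Fin 2) K) i j) ≤ 1) →
      ∀ {t y : ↥(unitaryGroupOfForm σ J)} {d : Fin 2 → Kˣ}, glDiagonal 2 K d = (t : GL (Fin 2) K) →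
        ∀ {m : ℕ}, y * t * y⁻¹ ∈ Ω m → ∀ i : Fin 2, Valued.v (ϖ ^ m * (d i : K)) ≤ 1 ∧ Valued.v (ϖ ^ m * ((d i : K))⁻¹) ≤ 1 := by
  intro K _ _ _ _ _ _ σ _hσσ hσv ϖ _hϖ J hJ Ω hmem t y d hd m hg i
  have htΩ : t ∈ (⇑Ω) m := K2E3ConjugatorHeightControlRankOneTwo.mem_heightBall_torus_of_conj_mem σ hσv hJ (⇑Ω) hmem hd hg
  obtain ⟨hA, hB⟩ := (hmem m t).1 htΩ
  refine ⟨?_, ?_⟩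
  · have h := hA i i
    rwa [← hd, coe_glDiagonal, Matrix.diagonal_apply_eq] at h
  · have h := hB i i
    rwa [← hd, K2E3CuspFormCancellationU3Torus.coe_inv_glDiagonal, Matrix.diagonal_apply_eq] at h

/-! ## §2 (DEPTH₂): the depth of a regular diagonal element from its token, in the payer's frozen `N = 3` constant -/

set_option maxHeartbeats 800000 in -- long ∀-closed statement (the payer's letter type verbatim)
/-- **(DEPTH₂) — THE PAYER'S LETTER `hDEPTH`, BYTE-EXACT**: for `t = diag d` with `|ϖ^m dᵢ| ≤ 1`, `|ϖ^m dᵢ⁻¹| ≤ 1`, `|ϖ| = exp(−1)` and `‖ϖ‖^τ ≤ T(t) = √√(‖disc χ_t‖·‖det t‖⁻²)`: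
`∀ i ≠ k, v(ϖ^{4τ+10m}) ≤ v(dᵢ − dₖ)` — from the SHARP ★ (M5e-2)₂ bound `v(ϖ^{4τ+4m}) ≤ v(dᵢ − dₖ)` and `|ϖ^{6m}| ≤ 1` (the first `Ω_m` binder is idle at `2 × 2`).
[cite: HarishChandra1970, Part VII §2 p. 69; §3 pp. 71–72] [cite: Rogawski1990, §3.1 p. 19] -/
theorem depth_letter :
    ∀ (K : Type) [Field K] [Valued K ℤᵐ⁰] [ValuativeRel K] [(Valued.v : Valuation K ℤᵐ⁰).Compatible] [IsNonarchimedeanLocalField K] [CharZero K]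
      {ϖ : K}, Valued.v ϖ = WithZero.exp (-1 : ℤ) → ∀ {d : Fin 2 → Kˣ} {m : ℕ}, (∀ i, Valued.v (ϖ ^ m * (d i : K)) ≤ 1) → (∀ i, Valued.v (ϖ ^ m * ((d i : K))⁻¹) ≤ 1) → ∀ {τ : ℕ},
      normAbs K ϖ ^ τ ≤ NNReal.sqrt (NNReal.sqrt (normAbs K ((((glDiagonal 2 K d : GL (Fin 2) K) : Matrix (Fin 2) (Fin 2) K)).charpoly.discr) *
          (normAbs K ((((glDiagonal 2 K d : GL (Fin 2) K) : Matrix (Fin 2) (Fin 2) K)).det) ^ 2)⁻¹)) → ∀ {i k : Fin 2}, i ≠ k → Valued.v (ϖ ^ (4 * τ + 10 * m)) ≤ Valued.v ((d i : K) - d k) := by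
  intro K _ _ _ _ _ _ ϖ hϖ d m _hd hd' τ hT i k hik
  have hϖ1 : Valued.v ϖ ≤ 1 := by
    rw [hϖ, ← WithZero.exp_zero, WithZero.exp_le_exp]; norm_num
  have h := K2E3SplitTorusDepthFromDiscriminantTwo.v_pow_le_v_sub_of_pow_normAbs_le_token hϖ hd' hT hik
  refine le_trans ?_ h
  calc Valued.v (ϖ ^ (4 * τ + 10 * m)) = Valued.v (ϖ ^ (4 * τ + 4 * m)) * Valued.v (ϖ ^ (6 * m)) := by
        rw [← map_mul, ← pow_add, show 4 * τ + 4 * m + 6 * m = 4 * τ + 10 * m by ring]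
    _ ≤ Valued.v (ϖ ^ (4 * τ + 4 * m)) * 1 := by
        refine mul_le_mul' le_rfl ?_
        rw [map_pow]; exact pow_le_one' hϖ1 _
    _ = Valued.v (ϖ ^ (4 * τ + 4 * m)) := mul_one _

end Summit.HodgeConjecture.HodgeConjecture.Cruxes.H413.K2E3SupercuspidalTruncatedCharTorusDepthLettersTwo

end
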